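import Literature.NumberTheory.GaloisRepresentations.EulerSystem
import Summits.BirchSwinnertonDyer.Rank1Residual.GaloisImage.KolyvaginDerivativeAlgebra
import Summits.BirchSwinnertonDyer.Rank1Residual.GaloisImage.KolyvaginDerivativeNormRelation
import HarnessLib

/-!
# The Euler-system axiom as a NORM RELATION at a common level, before and after a change of
# coefficients (cell `b2b-bsdres`, team n1011, seat p11 GEN 7, OWNERS row T-DER = skel/T-DER.md;
# file F3a)

HONEST FRAMING (cell `b2b-bsdres`, run/shared/lean/b2b/bsd-rank1-residual/, verbatim in every
file): the goal of the cell is to DELETE the COMBINATION-SHAPED residual classes of the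
Birch–Swinnerton-Dyer formula for ALL analytic-rank `≤ 1` elliptic curves over `ℚ` — "full BSD
formula for every rank `≤ 1` curve in class `C`" assembled STRICTLY from published theorems — so
that the rank-`≤ 1` remainder becomes exactly the CONSTRUCTION-SHAPED classes, which are TYPED
(missing-input `Prop`s), NOT attempted. This is not "finishing BSD". Team n1011 (N10 / N11, the
additive block X4 ∧ `p = 3`): research route on the CONSTRUCTION-SHAPED class X4; no claim beyond the
stated classes; nothing is booked. TOOL theorems of continuous Galois cohomology (no definition, no
named fact, no `sorry`); curve-free and `p`-free.

## What (row T-DER, THEOREM A1: [Rubin00] proof of Lemma 4.4.2, first display)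

Let `c` be an Euler system for `T` over the levels `L` (`IsEulerSystem L T p c`, tree file
`EulerSystem`: `Cor_{F(rq)/F(r)} c_{F(rq)} = P(Fr_q⁻¹ | T*; Fr_q⁻¹) c_{F(r)}`).  For an open normal
subgroup `U ≤ Gal(K̄/F_i(rq))` (a deeper level) and an element `σ ∈ Gal(K̄/F_i(r))` whose powers
`σ^j`, `j < N`, represent `Gal(F_i(rq)/F_i(r))` — i.e. `σ` maps to a generator of this cyclic
group of order `N` — the Euler-system axiom becomes, after restriction to `U`, the NORM RELATION

  `Σ_{j<N} σ^j · res_U c_{F(rq)} = P(Fr_q⁻¹ | T*; Fr_q⁻¹) · res_U c_{F(r)}`  in `H¹(U, T)`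

(`sum_conjMap_pow_resLe_eq_eulerFactorOp`; `res ∘ cor = Σ conj` is F2's `resLe_coresLe_eq_sum`,
and `res` commutes with the `Gal`-action and with the Euler-factor operator).  Pushing along an
equivariant coefficient map `red : T → T'` (e.g. `T → T/M`) gives the same relation in `H¹(U, T')`
with the Euler factor acting through `Fr_q⁻¹` (`sum_conjMap_pow_red_eq_aeval`).  These are the
hypotheses `hnorm` of F1's abstract Euler family (`Derivative.apply_deriv_apply_eq_of_eulerFamily`).

Also here: the coefficient-change map on `H¹(U, ·)` commutes with restriction and with the
`Gal`-action (`red_resLe`, `red_conjMap`), in degree one via explicit cocycles; and the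
group-theoretic preliminaries on the levels used by F3b (`level_antitone`, `mem_level_of_forall`,
`pow_mem_tameLevel_of_cov_inj` — `σ^N ∈ Gal(K̄/K(ℓ))` from the transversal property —, and
`exists_mem_closure_inv_mul_mem` — the chosen `σ_ℓ` generate `Γ_K` modulo the level).

## Conventions (referee-1 ACK-1 GEN 26 proviso (i); r1 riders R-A1 / R-A2)

* **Frobenius.** The relation is stated in the TREE's operator `eulerFactorOp T U p Fr`
  (`EulerSystem.lean`): Rubin's Euler factor `P(Fr⁻¹ | T*; X) = det(1 − Fr⁻¹ X | Hom(T, A(1)))`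
  (`rubinEulerFactor`) evaluated at the operator `Fr⁻¹` (`frobeniusInvOp T U Fr = conjMap … Fr⁻¹`),
  for an ARITHMETIC Frobenius `Fr` (`IsArithFrobAtPlace`).  No dualisation is performed here.
  Dictionary with [MR04] / [Kato], who write `P_ℓ(X) = det(1 − Fr_ℓ X | T)`: for `T = T_p E`
  (`T* ≅ T` by the Weil pairing) Rubin's polynomial is `1 − (a_ℓ/ℓ) X + X²/ℓ`, theirs is
  `1 − a_ℓ X + ℓ X²`; they correspond under `X ↦ ℓ X` (up to the unit `ℓ`), and both have value
  `≡ 2 − a_ℓ ≡ 0` at `X = 1` modulo `M` exactly when `ℓ ≡ 1`, `a_ℓ ≡ ℓ + 1 (mod M)` — the tree's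
  `Kato.IsKolyvaginPrime` (rider R-A1: the binders `M ∣ N_ℓ`, `M ∣ P_ℓ(1)` of the derivative
  construction are discharged BY NAME from it, up to the unit `ℓ`).  THEOREM A is insensitive to
  the choice (only `P(1) ≡ 0` enters); THEOREM C (the finite–singular relation) is not.
* **Levels.** Only the bottom `p`-layer `i` of `L.level i r` is used (any fixed `i`; `i = ⊥` in the
  application): the construction is `k`-free — the depth enters only through `M`.

References: K. Rubin, *Euler Systems*, Annals of Math. Studies 147 (2000), Def. 4.4.1, Lemma 4.4.2
and its proof; B. Mazur, K. Rubin, *Kolyvagin systems*, Mem. AMS 799 (2004), App. A.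
-/

noncomputable section

open CategoryTheory Function Finset Polynomial Field IsDedekindDomain
open scoped NumberField
open Literature.NumberTheory.GaloisRepresentations
open Literature.NumberTheory.EllipticCurves (subgroupInclusion subgroupConj)

universe u v w

namespace Summit.BirchSwinnertonDyer.Rank1Residual.GaloisImage

namespace Derivative

/-! ### Coefficient change on `H¹(U, ·)`: compatibility with restriction and the `Gal`-action -/

section Coeff

variable {R : Type u} [CommRing R] [TopologicalSpace R]
variable {G : Type v} [Group G] [TopologicalSpace G] [IsTopologicalGroup G]
variable {X Y : TopRep.{v} R G} (f : X ⟶ Y)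

/-- Coefficient change on explicit cocycles: `red_* [φ] = [red ∘ φ]` on `H¹(U, ·)`. [folklore] -/
theorem red_oneCocycleClass (U : Subgroup G) (φ : contOneCocycles (subgroupRep X U)) :
    ContinuousCohomology.map (ContinuousMonoidHom.id U) (X := subgroupRep X U) (Y := subgroupRep Y U)
        ((TopRep.resFunctor U.subtype).map f) 1 (oneCocycleClass _ φ) =
      oneCocycleClass (subgroupRep Y U)
        (contOneCocycles.pullback (ContinuousMonoidHom.id U)
          ((TopRep.resFunctor U.subtype).map f) φ) :=
  map_oneCocycleClass _ _ _ φ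

/-- **Coefficient change commutes with restriction** on `H¹` (`red_* ∘ res = res ∘ red_*`).
[folklore] -/
theorem red_resLe {U U' : Subgroup G} (h : U ≤ U') (y : continuousCohomology 1 (subgroupRep X U')) :
    ContinuousCohomology.map (ContinuousMonoidHom.id U) (X := subgroupRep X U) (Y := subgroupRep Y U)
        ((TopRep.resFunctor U.subtype).map f) 1 (resLe X h 1 y) =
      resLe Y h 1 (ContinuousCohomology.map (ContinuousMonoidHom.id U') (X := subgroupRep X U')
        (Y := subgroupRep Y U') ((TopRep.resFunctor U'.subtype).map f) 1 y) := by
  obtain ⟨φ, rfl⟩ := oneCocycleClass_surjective _ y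
  rw [resLe_oneCocycleClass, red_oneCocycleClass, red_oneCocycleClass, resLe_oneCocycleClass]
  exact congrArg _ (Subtype.ext (ContinuousMap.ext fun _ => rfl))

/-- **Coefficient change commutes with the `Gal`-action** on `H¹(U, ·)` for an equivariant
`red : X → Y` (`red_* ∘ (g·) = (g·) ∘ red_*`). [folklore] -/
theorem red_conjMap {U : Subgroup G} [U.Normal] (g : G) (y : continuousCohomology 1 (subgroupRep X U)) :
    ContinuousCohomology.map (ContinuousMonoidHom.id U) (X := subgroupRep X U) (Y := subgroupRep Y U)
        ((TopRep.resFunctor U.subtype).map f) 1 (conjMap X U g 1 y) =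
      conjMap Y U g 1 (ContinuousCohomology.map (ContinuousMonoidHom.id U) (X := subgroupRep X U)
        (Y := subgroupRep Y U) ((TopRep.resFunctor U.subtype).map f) 1 y) := by
  obtain ⟨φ, rfl⟩ := oneCocycleClass_surjective _ y
  rw [conjMap_oneCocycleClass, red_oneCocycleClass, red_oneCocycleClass, conjMap_oneCocycleClass]
  refine congrArg _ (Subtype.ext (ContinuousMap.ext fun x => ?_))
  change f.hom (X.ρ g (φ.1 (subgroupConj U g x))) = Y.ρ g (f.hom (φ.1 (subgroupConj U g x)))
  exact TopRep.hom_comm_apply f g _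

end Coeff

/-! ### Group-theoretic preliminaries on the levels -/

section Levels

variable {K : Type u} [Field K] [NumberField K] {ι : Type w} [Preorder ι] [OrderBot ι]
variable (L : EulerSystemLevels K ι)

/-- The levels are antitone in the set of primes: `s ⊆ s' → Gal(K̄/F_i(s')) ≤ Gal(K̄/F_i(s))`.
[folklore] -/
theorem level_antitone (i : ι) {s s' : Finset (HeightOneSpectrum (𝓞 K))} (h : s ⊆ s') :
    L.level i s' ≤ L.level i s := by
  intro g hg
  rw [EulerSystemLevels.mem_level_iff] at hg ⊢
  exact ⟨hg.1, fun q hq => hg.2 q (h hq)⟩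

/-- An element of the `p`-level lying in `Gal(K̄/K(q))` for every `q ∈ s` lies in `Gal(K̄/F_i(s))`.
[folklore] -/
theorem mem_level_of_forall {i : ι} {s : Finset (HeightOneSpectrum (𝓞 K))} {g : absoluteGaloisGroup K}
    (hp : g ∈ L.pLevel i) (h : ∀ q ∈ s, g ∈ L.tameLevel q) : g ∈ L.level i s :=
  L.mem_level_iff.mpr ⟨hp, h⟩

/-- **`σ^N ∈ Gal(K̄/K(ℓ))`** when the powers `σ^j`, `j < N`, hit every coset of `Gal(K̄/K(ℓ))`
(`hcov`) at most once (`hinj`): apply `hcov` to `σ^N`. [folklore] -/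
theorem pow_mem_tameLevel_of_cov_inj {ℓ : HeightOneSpectrum (𝓞 K)} {σ : absoluteGaloisGroup K} {N : ℕ}
    (hcov : ∀ g : absoluteGaloisGroup K, ∃ j < N, (σ ^ j)⁻¹ * g ∈ L.tameLevel ℓ)
    (hinj : ∀ j₁ < N, ∀ j₂ < N, (σ ^ j₁)⁻¹ * σ ^ j₂ ∈ L.tameLevel ℓ → j₁ = j₂) :
    σ ^ N ∈ L.tameLevel ℓ := by
  obtain ⟨j, hj, hmem⟩ := hcov (σ ^ N)
  rcases Nat.eq_zero_or_pos j with rfl | hjpos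
  · simpa using hmem
  · -- `σ^{N-j} ∈`, with `0 < N - j < N`: contradicts `hinj` at `(0, N - j)`
    exfalso
    have hNj : (σ ^ j)⁻¹ * σ ^ N = σ ^ (N - j) := by
      rw [inv_mul_eq_iff_eq_mul, ← pow_add, Nat.add_sub_cancel' hj.le]
    rw [hNj] at hmem
    have h0 : (σ ^ 0)⁻¹ * σ ^ (N - j) ∈ L.tameLevel ℓ := by simpa using hmem
    have := hinj 0 (lt_of_le_of_lt (Nat.zero_le j) hj) (N - j) (Nat.sub_lt_of_pos_le hjpos hj.le) h0
    omega

/-- **The chosen generators generate `Γ_K` modulo the level.**  If for each `ℓ ∈ s` the powers of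
`σ_ℓ` cover `Γ_K ⧸ Gal(K̄/K(ℓ))` (`hcov`) and `σ_ℓ ∈ Gal(K̄/K(q))` for `q ∈ s`, `q ≠ ℓ` (`hσ`),
then every `g ∈ Γ_K` is `w · u` with `w` in the subgroup generated by the `σ_ℓ` (`ℓ ∈ s`) and
`u ∈ Gal(K̄/K(q))` for all `q ∈ s` (induction on `s`). [folklore] -/
theorem exists_mem_closure_inv_mul_mem (σ : HeightOneSpectrum (𝓞 K) → absoluteGaloisGroup K)
    (N : HeightOneSpectrum (𝓞 K) → ℕ) (s : Finset (HeightOneSpectrum (𝓞 K)))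
    (hσ : ∀ ℓ ∈ s, ∀ q ∈ s, q ≠ ℓ → σ ℓ ∈ L.tameLevel q)
    (hcov : ∀ ℓ ∈ s, ∀ g : absoluteGaloisGroup K, ∃ j < N ℓ, (σ ℓ ^ j)⁻¹ * g ∈ L.tameLevel ℓ)
    (g : absoluteGaloisGroup K) :
    ∃ w ∈ Subgroup.closure (σ '' (s : Set (HeightOneSpectrum (𝓞 K)))),
      ∀ q ∈ s, w⁻¹ * g ∈ L.tameLevel q := by
  classical
  induction s using Finset.induction_on generalizing g with
  | empty => exact ⟨1, Subgroup.one_mem _, fun q hq => absurd hq (Finset.notMem_empty q)⟩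
  | insert ℓ s hℓs ih =>
    obtain ⟨j, -, hj⟩ := hcov ℓ (Finset.mem_insert_self ℓ s) g
    have hσ' : ∀ ℓ' ∈ s, ∀ q ∈ s, q ≠ ℓ' → σ ℓ' ∈ L.tameLevel q := fun ℓ' hℓ' q hq hne =>
      hσ ℓ' (Finset.mem_insert_of_mem hℓ') q (Finset.mem_insert_of_mem hq) hne
    have hcov' : ∀ ℓ' ∈ s, ∀ g : absoluteGaloisGroup K, ∃ j < N ℓ', (σ ℓ' ^ j)⁻¹ * g ∈ L.tameLevel ℓ' :=
      fun ℓ' hℓ' => hcov ℓ' (Finset.mem_insert_of_mem hℓ')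
    obtain ⟨w', hw', hw'q⟩ := ih hσ' hcov' ((σ ℓ ^ j)⁻¹ * g)
    refine ⟨σ ℓ ^ j * w', Subgroup.mul_mem _ (Subgroup.pow_mem _ (Subgroup.subset_closure
      (Set.mem_image_of_mem σ (Finset.mem_coe.mpr (Finset.mem_insert_self ℓ s)))) j)
      (Subgroup.closure_mono (Set.image_mono (Finset.coe_subset.mpr (Finset.subset_insert ℓ s))) hw'),
      fun q hq => ?_⟩
    have e : (σ ℓ ^ j * w')⁻¹ * g = w'⁻¹ * ((σ ℓ ^ j)⁻¹ * g) := by group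
    rw [e]
    rcases Finset.mem_insert.mp hq with rfl | hq
    · -- `q = ℓ`: `w'` lies in `Gal(K̄/K(ℓ))` since every generator `σ_{ℓ'}`, `ℓ' ∈ s`, does
      haveI : (L.tameLevel q).Normal := Subgroup.Normal.of_commutator_le _ (L.commutator_le_tameLevel q)
      have hcl : Subgroup.closure (σ '' (s : Set (HeightOneSpectrum (𝓞 K)))) ≤ L.tameLevel q := by
        rw [Subgroup.closure_le]
        rintro _ ⟨ℓ', hℓ', rfl⟩
        exact hσ ℓ' (Finset.mem_insert_of_mem hℓ') q (Finset.mem_insert_self q s)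
          (fun h => hℓs (h ▸ Finset.mem_coe.mp hℓ'))
      exact Subgroup.mul_mem _ (Subgroup.inv_mem _ (hcl hw')) hj
    · exact hw'q q hq

end Levels

/-! ### The Euler-system axiom at a common level -/

section Euler

variable {K : Type u} [Field K] [NumberField K] {ι : Type w} [Preorder ι] [OrderBot ι]
variable {A : Type v} [CommRing A] [TopologicalSpace A]
variable {M : Type u} [AddCommGroup M] [Module A M] [TopologicalSpace M] [IsTopologicalAddGroup M]
  [ContinuousSMul A M] [Module.Free A M] [Module.Finite A M]
variable {L : EulerSystemLevels K ι} {T : GaloisRep K A M} {p : ℕ} [Fact p.Prime] [Algebra ℤ_[p] A]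
variable {c : ∀ (i : ι) (r : L.Ideals), H1 T (L.level i r.1)}

omit [NumberField K] in
/-- **`res` commutes with the Euler-factor operator**: for `U ≤ U'` normal in `Γ_K`,
`res_U (P(Fr⁻¹ | T*; Fr⁻¹) y) = P(Fr⁻¹ | T*; Fr⁻¹) (res_U y)` (`Fr⁻¹` acts through `conjMap`,
which commutes with restriction, F2 `resLe_conjMap`). [folklore] -/
theorem resLe_eulerFactorOp {U U' : Subgroup (absoluteGaloisGroup K)} [U.Normal] [U'.Normal]
    (h : U ≤ U') (Fr : absoluteGaloisGroup K) (y : H1 T U') :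
    resLe T.toTopRep h 1 (eulerFactorOp T U' p Fr y) = eulerFactorOp T U p Fr (resLe T.toTopRep h 1 y) :=
  apply_aeval_apply_eq_of_comm (resLe T.toTopRep h 1).hom.toLinearMap
    (F := frobeniusInvOp T U' Fr) (F' := frobeniusInvOp T U Fr)
    (fun v => resLe_conjMap T.toTopRep h Fr⁻¹ v) _ y

/-- **The Euler-system axiom as a norm relation at a common level** ([Rubin00], proof of Lemma
4.4.2: "`N_q c_{F(rq)} = res (Cor c_{F(rq)}) = P(Fr_q⁻¹ | T*; Fr_q⁻¹) c_{F(r)}`").  For an Euler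
system `c`, a usable prime `q ∉ r` ramified in `F_i(rq)`, an arithmetic Frobenius `Fr` at `q`, a
normal subgroup `U ≤ Gal(K̄/F_i(rq))`, and `σ ∈ Gal(K̄/F_i(r))` whose powers `σ^j` (`j < N`) form a
system of representatives of `Gal(F_i(rq)/F_i(r))` (`hcov`: every coset is hit; `hinj`: at most
once):  `Σ_{j<N} σ^j · res_U c_{i,rq} = P(Fr⁻¹ | T*; Fr⁻¹) · res_U c_{i,r}` in `H¹(U, T)`.
[cite: Rubin2000, Lemma 4.4.2 (proof)] -/
theorem sum_conjMap_pow_resLe_eq_eulerFactorOp (hc : IsEulerSystem L T p c) (i : ι) (r : L.Ideals)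
    (q : HeightOneSpectrum (𝓞 K)) (hq : q ∈ L.primes) (hqr : q ∉ r.1)
    (hram : ¬ SubgroupIsUnramifiedAt K (L.level i (r.cons q hq).1) q)
    (Fr : absoluteGaloisGroup K) (hFr : IsArithFrobAtPlace K q Fr)
    {U : Subgroup (absoluteGaloisGroup K)} [U.Normal] (hU : U ≤ L.level i (r.cons q hq).1)
    (σ : absoluteGaloisGroup K) (N : ℕ) (hσ : σ ∈ L.level i r.1)
    (hcov : ∀ g ∈ L.level i r.1, ∃ j < N, (σ ^ j)⁻¹ * g ∈ L.level i (r.cons q hq).1)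
    (hinj : ∀ j₁ < N, ∀ j₂ < N, (σ ^ j₁)⁻¹ * σ ^ j₂ ∈ L.level i (r.cons q hq).1 → j₁ = j₂) :
    ∑ j ∈ range N, conjMap T.toTopRep U (σ ^ j) 1 (resLe T.toTopRep hU 1 (c i (r.cons q hq))) =
      eulerFactorOp T U p Fr
        (resLe T.toTopRep (hU.trans (L.level_insert_le i r.1 q)) 1 (c i r)) := by
  classical
  -- notation
  set H' := L.level i r.1 with hH'
  set H := L.level i (r.cons q hq).1 with hH
  have hle : H ≤ H' := L.level_insert_le i r.1 q
  letI : Fintype (H' ⧸ H.subgroupOf H') := Fintype.ofFinite _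
  have hcc : L.coresCons T i r q hq =
      coresLe T.toTopRep hle (L.isOpen_level i (r.cons q hq).1) := rfl
  -- the Euler-system axiom, restricted to `U`
  have hES := hc.cores_cons i r q hq hqr hram Fr hFr
  have hES' := congrArg (resLe T.toTopRep (hU.trans hle) 1) hES
  -- the transversal `j ↦ σ^j` of `H' ⧸ H`
  let e : Fin N → H' ⧸ H.subgroupOf H' := fun j => QuotientGroup.mk ⟨σ ^ (j : ℕ), H'.pow_mem hσ j⟩
  have he_inj : Function.Injective e := by
    intro j₁ j₂ hj
    have h12 : (⟨σ ^ (j₁ : ℕ), H'.pow_mem hσ j₁⟩ : H')⁻¹ * ⟨σ ^ (j₂ : ℕ), H'.pow_mem hσ j₂⟩ ∈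
        H.subgroupOf H' := QuotientGroup.eq.mp hj
    rw [Subgroup.mem_subgroupOf] at h12
    exact Fin.ext (hinj j₁ j₁.2 j₂ j₂.2 h12)
  have he_surj : Function.Surjective e := by
    intro x
    obtain ⟨g, rfl⟩ := QuotientGroup.mk_surjective x
    obtain ⟨j, hj, hjg⟩ := hcov g g.2
    refine ⟨⟨j, hj⟩, QuotientGroup.eq.mpr ?_⟩
    rw [Subgroup.mem_subgroupOf]
    exact hjg
  let eE : Fin N ≃ H' ⧸ H.subgroupOf H' := Equiv.ofBijective e ⟨he_inj, he_surj⟩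
  -- representatives
  let s : H' ⧸ H.subgroupOf H' → H' := fun x => ⟨σ ^ ((eE.symm x : Fin N) : ℕ), H'.pow_mem hσ _⟩
  have hs : ∀ x, (s x : H' ⧸ H.subgroupOf H') = x := fun x => by
    change e (eE.symm x) = x
    exact eE.apply_symm_apply x
  -- `res_U ∘ cor = Σ conj` along the transversal, then reindex by `j`
  have hsum : resLe T.toTopRep (hU.trans hle) 1 (L.coresCons T i r q hq (c i (r.cons q hq))) =
      ∑ j ∈ range N, conjMap T.toTopRep U (σ ^ j) 1 (resLe T.toTopRep hU 1 (c i (r.cons q hq))) := by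
    rw [← resLe_resLe T.toTopRep hU hle, hcc,
      resLe_coresLe_eq_sum T.toTopRep hle (L.isOpen_level i _) hs, map_sum,
      ← Fin.sum_univ_eq_sum_range (fun j => conjMap T.toTopRep U (σ ^ j) 1
        (resLe T.toTopRep hU 1 (c i (r.cons q hq)))), ← eE.sum_comp]
    refine Finset.sum_congr rfl fun x _ => ?_
    have hx : ((s (eE x) : H') : absoluteGaloisGroup K) = σ ^ (x : ℕ) := by
      change σ ^ ((eE.symm (eE x) : Fin N) : ℕ) = σ ^ (x : ℕ)
      rw [Equiv.symm_apply_apply]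
    rw [hx]
    exact resLe_conjMap T.toTopRep hU _ _
  rw [← hsum, hES', resLe_eulerFactorOp]

variable {M' : Type u} [AddCommGroup M'] [Module A M'] [TopologicalSpace M'] [IsTopologicalAddGroup M']
  [ContinuousSMul A M'] {T' : GaloisRep K A M'}

/-- **The norm relation after a change of coefficients.**  With the data of
`sum_conjMap_pow_resLe_eq_eulerFactorOp` and an equivariant continuous `A`-linear map
`red : T → T'` (e.g. `T → T/M`), writing `red_*` for the induced map on `H¹(U, ·)`:
`Σ_{j<N} σ^j · red_* res_U c_{i,rq} = P(Fr⁻¹) · red_* res_U c_{i,r}` in `H¹(U, T')`, where the Euler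
factor `P = P(Fr⁻¹ | T*; X) ∈ A[X]` of `T` acts on `H¹(U, T')` through `Fr⁻¹` (`frobeniusInvOp`).
This is hypothesis `hnorm` of F1's abstract Euler family. [cite: Rubin2000, Lemma 4.4.2 (proof)] -/
theorem sum_conjMap_pow_red_eq_aeval (hc : IsEulerSystem L T p c) (red : T.toTopRep ⟶ T'.toTopRep)
    (i : ι) (r : L.Ideals) (q : HeightOneSpectrum (𝓞 K)) (hq : q ∈ L.primes) (hqr : q ∉ r.1)
    (hram : ¬ SubgroupIsUnramifiedAt K (L.level i (r.cons q hq).1) q)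
    (Fr : absoluteGaloisGroup K) (hFr : IsArithFrobAtPlace K q Fr)
    {U : Subgroup (absoluteGaloisGroup K)} [U.Normal] (hU : U ≤ L.level i (r.cons q hq).1)
    (σ : absoluteGaloisGroup K) (N : ℕ) (hσ : σ ∈ L.level i r.1)
    (hcov : ∀ g ∈ L.level i r.1, ∃ j < N, (σ ^ j)⁻¹ * g ∈ L.level i (r.cons q hq).1)
    (hinj : ∀ j₁ < N, ∀ j₂ < N, (σ ^ j₁)⁻¹ * σ ^ j₂ ∈ L.level i (r.cons q hq).1 → j₁ = j₂) :
    ∑ j ∈ range N, conjMap T'.toTopRep U (σ ^ j) 1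
        (ContinuousCohomology.map (ContinuousMonoidHom.id U) (X := subgroupRep T.toTopRep U)
          (Y := subgroupRep T'.toTopRep U) ((TopRep.resFunctor U.subtype).map red) 1
          (resLe T.toTopRep hU 1 (c i (r.cons q hq)))) =
      aeval (frobeniusInvOp T' U Fr)
        (rubinEulerFactor T.toRepresentation (cyclotomicCharacterToUnits K p A) Fr)
        (ContinuousCohomology.map (ContinuousMonoidHom.id U) (X := subgroupRep T.toTopRep U)
          (Y := subgroupRep T'.toTopRep U) ((TopRep.resFunctor U.subtype).map red) 1
          (resLe T.toTopRep (hU.trans (L.level_insert_le i r.1 q)) 1 (c i r))) := by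
  have h := congrArg (ContinuousCohomology.map (ContinuousMonoidHom.id U)
    (X := subgroupRep T.toTopRep U) (Y := subgroupRep T'.toTopRep U)
    ((TopRep.resFunctor U.subtype).map red) 1)
    (sum_conjMap_pow_resLe_eq_eulerFactorOp hc i r q hq hqr hram Fr hFr hU σ N hσ hcov hinj)
  rw [map_sum] at h
  rw [← Finset.sum_congr rfl fun j _ => red_conjMap red (σ ^ j)
    (resLe T.toTopRep hU 1 (c i (r.cons q hq))), h]
  exact apply_aeval_apply_eq_of_comm
    (ContinuousCohomology.map (ContinuousMonoidHom.id U) (X := subgroupRep T.toTopRep U)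
      (Y := subgroupRep T'.toTopRep U) ((TopRep.resFunctor U.subtype).map red) 1).hom.toLinearMap
    (F := frobeniusInvOp T U Fr) (F' := frobeniusInvOp T' U Fr) (fun v => red_conjMap red Fr⁻¹ v)
    (rubinEulerFactor T.toRepresentation (cyclotomicCharacterToUnits K p A) Fr) _

end Euler

end Derivative

end Summit.BirchSwinnertonDyer.Rank1Residual.GaloisImage

end
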